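import Literature.AlgebraicGeometry.Motives.AbelianVarietyKummerPairing
import Literature.AlgebraicGeometry.Motives.CartierDivisorCocycle
import Literature.NumberTheory.Transcendental.AnalytificationProofs
import Literature.NumberTheory.Transcendental.AnalytificationFunctorialityProofs
import Literature.AlgebraicGeometry.HodgeTheory.ConjugateComplexPoints
import HarnessLib

/-!
# The Kummer pairing read at points: `h(σ · x) = e_N(σ, E) · h(x)` (Lang, *Abelian Varieties*, VII §2, Prop. 3)

Layer `Literature/AlgebraicGeometry/Motives`, namespace `Literature.AlgebraicGeometry.Motives`.  PROOF FILE (theorems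
only; no definition, no named fact).  The Kummer pairing `e_N(σ, E) = kummerConst hh σ ∈ K` of an abelian variety
`A/K` (`Motives/AbelianVarietyKummerPairing`: the constant `c` with `t_σ^♯ h = c · h` in `K(A)` for a trivializer
`h` of `[N]^* E`, `AbelianVariety.IsTrivializer`) is an identity of RATIONAL FUNCTIONS; this file reads it at the
`K`-rational points where `h` is given by a section: if `h` is the rational function of `f ∈ Γ(U, 𝒪_A)`, then
`f(σ · x) = e_N(σ, E) · f(x)` for every `x ∈ A(K)` with `x, σ·x ∈ U` — Lang's printed form «`ω(u + a) = e_n(a, X) ω(u)`»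
as an identity of VALUES.  Ingredients (with the tree's `AlgPoints.evalOrZero_map`,
evaluation is natural in the morphism), all generic and recorded here for re-use:

* `AlgPoints.evalOrZero_eq_mul_of_ofSection_eq` — identities `s₁ = s₃ s₄` in `K(X)` hold for the values at
  `L`-points;
* `AlgPoints.evalOrZero_top_hom_appTop` — the value of the constant function `c ∈ K ⊆ Γ(X, 𝒪_X)` at an `L`-point
  is `c` (total-function form of the tree's `AlgPoints.eval_appTop_algebraMap`);
* `AbelianVariety.map_translation` — on `K`-points, `t_σ` is `x ↦ σ · x` (the tree's `comp_translation`);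
* `AbelianVariety.ofSection_translation_app` — the rational function of `t_σ^* f` is `t_σ^♯` of that of `f`;
* `AbelianVariety.evalOrZero_translation_mul_eq_kummerConst_mul` — the statement above.

Purpose (cell hodgecm-mathlib, D5 junction «algebraic `e_N` = analytic `e_N`» (J), step (1)/(7): the algebraic side
of the comparison is read at complex points through this lemma).

## References
* [Lang1983AbelianVarieties] S. Lang, *Abelian Varieties*, Ch. VII §2, Prop. 3 («`ω(u + a) = e_n(a, X) ω(u)`»).
* [GortzWedhorn2020] U. Görtz, T. Wedhorn, *Algebraic Geometry I* (2nd ed. 2020), Prop. 3.29 (sections and rational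
  functions; injectivity of `Γ(U, 𝒪_X) → K(X)`), (4.12) (points with values in a field and evaluation).
-/

noncomputable section

universe u

open CategoryTheory AlgebraicGeometry TopologicalSpace Opposite
open scoped MonObj

namespace Literature.AlgebraicGeometry.Motives

/-! ### Generic: constants evaluate to themselves; identities of rational functions hold for values -/

namespace AlgPoints

variable {k : Type u} [Field k] {X Y : SchemeOver k} {L : Type u} [Field L] [Algebra k L]

/-- **Constants evaluate to themselves** (total-function form of the tree's `AlgPoints.eval_appTop_algebraMap`):
the global function `c ∈ K ⊆ Γ(X, 𝒪_X)` takes the value `algebraMap K L c` at every `L`-point.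
[cite: GortzWedhorn2020, (4.12) (p. 108)] -/
theorem evalOrZero_top_hom_appTop (x : AlgPoints X L) (c : k) :
    evalOrZero ⊤ (X.hom.appTop ((Scheme.ΓSpecIso (.of k)).inv c)) x = algebraMap k L c := by
  rw [evalOrZero_of_mem _ (show x.pt ∈ (⊤ : X.left.Opens) from trivial), eval_appTop_algebraMap]

/-- **Identities in `K(X)` hold for the values at `L`-points**: sections `s₁, s₃, s₄` over opens containing the
point `P` with `s₁ = s₃ s₄` as rational functions take values with `s₁(P) = s₃(P) s₄(P)` (restrict to the intersection,
where `Γ → K(X)` is injective and evaluation is a ring homomorphism; Görtz–Wedhorn I Prop. 3.29 — the `L`-point form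
of the tree's `HodgeTheory.evalOrZero_eq_mul_of_ofSection`). [cite: GortzWedhorn2020, Prop. 3.29 (p. 102)] -/
theorem evalOrZero_eq_mul_of_ofSection_eq [IsIntegral X.left] {O₁ O₃ O₄ : X.left.Opens} (s₁ : Γ(X.left, O₁))
    (s₃ : Γ(X.left, O₃)) (s₄ : Γ(X.left, O₄)) {P : AlgPoints X L} (h₁ : P.pt ∈ O₁) (h₃ : P.pt ∈ O₃)
    (h₄ : P.pt ∈ O₄)
    (H : RatFn.ofSection (RatFn.genericPoint_mem_of_mem h₁) s₁ =
      RatFn.ofSection (RatFn.genericPoint_mem_of_mem h₃) s₃ * RatFn.ofSection (RatFn.genericPoint_mem_of_mem h₄) s₄) :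
    evalOrZero O₁ s₁ P = evalOrZero O₃ s₃ P * evalOrZero O₄ s₄ P := by
  have hO : P.pt ∈ O₁ ⊓ (O₃ ⊓ O₄) := ⟨h₁, h₃, h₄⟩
  have e₁ : O₁ ⊓ (O₃ ⊓ O₄) ≤ O₁ := inf_le_left
  have e₃ : O₁ ⊓ (O₃ ⊓ O₄) ≤ O₃ := inf_le_right.trans inf_le_left
  have e₄ : O₁ ⊓ (O₃ ⊓ O₄) ≤ O₄ := inf_le_right.trans inf_le_right
  rw [← evalOrZero_map_homOfLE e₁ s₁ hO, ← evalOrZero_map_homOfLE e₃ s₃ hO, ← evalOrZero_map_homOfLE e₄ s₄ hO,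
    evalOrZero_of_mem _ hO, evalOrZero_of_mem _ hO, evalOrZero_of_mem _ hO, ← evalRingHom_apply,
    ← evalRingHom_apply, ← evalRingHom_apply, ← map_mul]
  congr 1
  refine RatFn.section_ext fun hg ↦ ?_
  simp only [map_mul, RatFn.ofSection_map]
  exact H

end AlgPoints

/-! ### Abelian varieties: translations on points, on sections, and the Kummer pairing on values -/

namespace AbelianVariety

open RatFn AlgPoints

variable {K : Type u} [Field K] (A : AbelianVariety K)

/-- **On `K`-points, `t_σ` is multiplication by `σ`**: `map (t_σ) x = σ · x` (the tree's `comp_translation`).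
[cite: GortzWedhorn2020, (4.12) (p. 108)] -/
theorem map_translation (σ x : A.Points K) : AlgPoints.map (A.translation σ) x = σ * x :=
  A.comp_translation x σ

/-- **The rational function of `t_σ^* f` is `t_σ^♯` of the rational function of `f`** (`t_σ` is dominant, indeed an
isomorphism; the tree's `RatFn.functionFieldMap_ofSection`). [cite: GortzWedhorn2020, Prop. 3.29 (p. 102)] -/
theorem ofSection_translation_app (σ : A.Points K) {U : A.X.left.Opens} (hU : genericPoint A.X.left ∈ U)
    (f : Γ(A.X.left, U)) :
    ofSection (genericPoint_mem_preimage (A.translation σ).left hU) ((A.translation σ).left.app U f) =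
      A.translFF σ (ofSection hU f) :=
  (functionFieldMap_ofSection (A.translation σ).left hU f).symm

/-- The constant `c ∈ K ⊆ K(A)` is the rational function of the global section `c ∈ Γ(A, 𝒪_A)`. [folklore] -/
private theorem algebraMap_functionField_eq_ofSection (c : K) :
    algebraMap K A.X.left.functionField c =
      ofSection (U := ⊤) trivial (A.X.hom.appTop ((Scheme.ΓSpecIso (.of K)).inv c)) :=
  algebraMap_stalk_apply (X := A.X.left) K (genericPoint A.X.left) c

variable {A} {N : ℕ} [IsDominant (Hom.toSchemeHom ((N : ℤ) • 𝟙 A))]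

/-- **The Kummer pairing on values (Lang VII §2, Prop. 3: «`ω(u + a) = e_n(a, X) ω(u)`»).**  Let `h` trivialize
`[N]^* E` (`[N]^* E + div h = 0`) and let `σ ∈ A[N](K)`, so that `t_σ^♯ h = e_N(σ, E) · h` in `K(A)`
(`translFF_eq_kummerConst_smul`).  If `h` is the rational function of a section `f ∈ Γ(U, 𝒪_A)` then for every
`K`-point `x` with `x ∈ U` and `σ · x ∈ U`:  `f(σ · x) = e_N(σ, E) · f(x)`.
[cite: Lang1983AbelianVarieties, Ch. VII §2 Prop. 3] [cite: GortzWedhorn2020, Prop. 3.29 (p. 102)] -/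
theorem evalOrZero_translation_mul_eq_kummerConst_mul {E : CartierDivisor A.X.left}
    {h : A.X.left.functionField} (hh : A.IsTrivializer (n := N) E h) (σ : A.torsionPoints K N)
    {U : A.X.left.Opens} (hU : genericPoint A.X.left ∈ U) (f : Γ(A.X.left, U)) (hf : ofSection hU f = h)
    (x : A.Points K) (hx : x.pt ∈ U) (hσx : ((σ : A.Points K) * x).pt ∈ U) :
    evalOrZero U f ((σ : A.Points K) * x) = A.kummerConst hh σ * evalOrZero U f x := by
  -- the identity `t_σ^♯ h = c · h` in `K(A)`, written with sections
  have hx' : x.pt ∈ (A.translation (σ : A.Points K)).left ⁻¹ᵁ U := by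
    change ((A.translation (σ : A.Points K)).left x.pt) ∈ U
    have : (AlgPoints.map (A.translation (σ : A.Points K)) x).pt ∈ U := by rwa [map_translation]
    exact this
  have H : ofSection (genericPoint_mem_of_mem hx') ((A.translation (σ : A.Points K)).left.app U f) =
      ofSection (genericPoint_mem_of_mem (show x.pt ∈ (⊤ : A.X.left.Opens) from trivial))
          (A.X.hom.appTop ((Scheme.ΓSpecIso (.of K)).inv (A.kummerConst hh σ))) *
        ofSection (genericPoint_mem_of_mem hx) f := by
    rw [A.ofSection_translation_app _ hU f, ← algebraMap_functionField_eq_ofSection, hf]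
    exact A.translFF_eq_kummerConst_smul hh σ
  -- read it at the point `x`
  have hval := evalOrZero_eq_mul_of_ofSection_eq _ _ _ hx' (show x.pt ∈ (⊤ : A.X.left.Opens) from trivial) hx H
  rw [← AlgPoints.evalOrZero_map, map_translation, evalOrZero_top_hom_appTop] at hval
  simpa using hval

end AbelianVariety

end Literature.AlgebraicGeometry.Motives

end
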